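import Literature.Geometry.Symplectic.SymplecticWedgeSquare
import Literature.Topology.FourManifolds.SigPosOfNonzeroRealClass
import Literature.Geometry.Symplectic.SymplecticSurfaceNonTorsion
import HarnessLib

/-!
# `b⁺ ≥ 1` for closed symplectic `4`-manifolds, from de Rham's theorem

McDuff–Salamon (2017), proof of Thm. 13.3.11 (and §4.4 after Ex. 4.4.1): on a closed connected
symplectic `4`-manifold `(N, ω)`, `∫_N ω ∧ ω > 0`, so `[ω] ∪ [ω] ≠ 0` and, for the symplectic
orientation, `b⁺ ≥ 1`. This is conjunct (i) of the named fact
`Literature.Geometry.Symplectic.canonicalClass_sq_and_adjunction_of_symplectic_four`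
(`CanonicalClassSqAndAdjunctionOfSymplecticFour.lean`), which quantifies the orientation
existentially. We prove it from the tree's bricks

* `wedge_self_castDeg_apply_ne_zero`, `wedge_self_castDeg_mem_closedSmoothForms`
  (`SymplecticWedgeSquare.lean`: `ω ∧ ω` is a nowhere-vanishing closed top form),
* `deRhamCohomology_mk_ne_zero_of_forall_ne_zero`,
  `eq_zero_of_kroneckerPairing_coeffChange_fundamentalClass_eq_zero`
  (`DeRhamFundamentalClassPairing.lean`: it is not exact, and `H⁴(N; ℝ)` is detected by `[N] ⊗ 1`),
* `one_le_sigPos_intersectionForm_of_real` (`IntersectionFormRealPositive.lean`: a real class of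
  positive square forces `b⁺ ≥ 1`),

granted a de Rham isomorphism family that is MULTIPLICATIVE (`[α ∧ β] ↦ [α] ⌣ [β]`):

* `kroneckerPairing_cupProduct_deRhamIso_ne_zero` — for any multiplicative family `e` (in the
  sense of `DeRhamIsoFamily.IsMultiplicative`) and any `ℤ`-orientation `μ`, the real class
  `y = e [s]` of a symplectic form has `⟨y ∪ y, [N] ⊗ 1⟩ ≠ 0`;
* `exists_orientation_kroneckerPairing_cupProduct_pos` — hence `> 0` for one of the two
  orientations `±μ`;
* `exists_orientation_one_le_sigPos_of_deRhamIsoFamily` — hence **`∃ μ, 1 ≤ sigPos Q_{N, μ}`**;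
* `exists_orientation_one_le_sigPos_of_exists_deRhamIsoFamily` — the same **from the named fact
  `Literature.NumberTheory.Transcendental.exists_deRhamIsoFamily (𝓡 4)`** (de Rham's theorem in
  its natural + multiplicative + normalised form; Warner (1983), Thm. 5.36 / 5.45), taken as an
  explicit hypothesis (D-0026: it is an EXISTING named fact of the tree, whose residual content is
  the multiplicativity of the integration family, `exists_deRhamIsoFamily_of_isMultiplicative`);
(for the integration family `integrationDeRhamIsoFamily ℝ⁴` itself, multiplicativity gives the
sharper `exists_isSymplecticOrientationOf_one_le_sigPos_of_isMultiplicative` of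
`TaubesCanonicalClassSymplecticCurveFourProofs.lean`, which also names the orientation).

So "`b⁺(μ) ≥ 1` for the orientation `μ` on which `e [s] ⌣ e [s]` is positive" is PROVED MODULO
`exists_deRhamIsoFamily (𝓡 4)`. Since the named fact quantifies its orientation EXISTENTIALLY, its
conjunct (i) taken alone needs no multiplicativity at all: `[s] ≠ 0` in `H²_dR(N)` (if `s = dθ` then `s ∧ s = d(θ ∧ s)` would be
exact), so `H²(N; ℝ) ≠ 0` by the (additive) de Rham isomorphism, and a non-zero even-degree middle
cohomology forces `b⁺ ≥ 1` for one of the two orientations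
(`Literature.Topology.FourManifolds.exists_orientation_one_le_sigPos_of_ne_zero`):

* `deRhamCohomology_mk_ne_zero_of_nondegenerate` — `[s] ≠ 0` for a symplectic form on a closed
  `4`-manifold (McDuff–Salamon (2017), §4.4 after Ex. 4.4.1);
* `exists_orientation_one_le_sigPos` — **conjunct (i) of the named fact, unconditionally**:
  `∃ μ, 1 ≤ sigPos Q_{N, μ}`;
* `canonicalClass_sq_and_adjunction_of_symplectic_four_parts_i_iiia` — conjuncts (i) and (iii)(a)
  (`SymplecticSurfaceNonTorsion.lean`) together, in the exact binders of the named fact.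

Everything here is proved; no definitions, no named facts.

## References

* D. McDuff, D. Salamon, *Introduction to Symplectic Topology*, 3rd ed., OUP (2017), §4.4 after
  Ex. 4.4.1; proof of Thm. 13.3.11. [McDuffSalamon2017]
* F. W. Warner, *Foundations of Differentiable Manifolds and Lie Groups*, GTM 94 (1983),
  Thm. 5.36, Thm. 5.45. [WarnerGTM94]
-/

noncomputable section

open scoped Manifold ContDiff Topology
open Set Function Module
open Literature.AlgebraicTopology.SingularHomology Literature.Geometry.Kaehler
  Literature.Geometry.Manifold Literature.NumberTheory.Transcendental Literature.Topology.FourManifolds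

namespace Literature.Geometry.Symplectic

variable {N : Type} [TopologicalSpace N] [T2Space N] [CompactSpace N] [ConnectedSpace N]
  [ChartedSpace (EuclideanSpace ℝ (Fin 4)) N] [IsManifold (𝓡 4) ∞ N]

/-- **`⟨y ∪ y, [N] ⊗ 1⟩ ≠ 0` for the class `y = e [s]` of a symplectic form under any
MULTIPLICATIVE de Rham isomorphism family `e`** (`DeRhamIsoFamily.IsMultiplicative`), for every
homological `ℤ`-orientation `μ` of the closed connected `4`-manifold `N`:
`y ∪ y = e ([s] ⌣ [s]) = e [s ∧ s]`, and `[s ∧ s] ≠ 0` (the volume form `s ∧ s` is not exact,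
Stokes) while `H⁴(N; ℝ)` is detected by `[N] ⊗ 1` (McDuff–Salamon (2017), proof of Thm. 13.3.11:
`∫ ω ∧ ω > 0`). [cite: McDuffSalamon2017, proof of Thm. 13.3.11] -/
theorem kroneckerPairing_cupProduct_deRhamIso_ne_zero (e : DeRhamIsoFamily (𝓡 4))
    (he : e.IsMultiplicative) (μ : HomologicalOrientation ℤ N 4) {s : MForm (𝓡 4) N ℝ 2}
    (hs : s ∈ closedSmoothForms (𝓡 4) N ℝ 2)
    (hnd : ∀ x (v : TangentSpace (𝓡 4) x), v ≠ 0 → ∃ w : TangentSpace (𝓡 4) x, s x ![v, w] ≠ 0) :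
    kroneckerPairing ℝ ℝ N 4
        (cupProduct two_add_two_eq_four (e N 2 (deRhamCohomology.mk ⟨s, hs⟩))
          (e N 2 (deRhamCohomology.mk ⟨s, hs⟩)))
        (singularHomology.coeffChange N (algebraMap ℤ ℝ : ℤ →+* ℝ).toAddMonoidHom 4
          μ.fundamentalClass) ≠ 0 := by
  haveI := wedgeFacts_four (N := N)
  have h := he N 2 2 4 two_add_two_eq_four (deRhamCohomology.mk ⟨s, hs⟩) (deRhamCohomology.mk ⟨s, hs⟩)
  rw [← h, cup_self_deRham_eq hs]
  have hmk : deRhamCohomology.mk ⟨(s.wedge s).castDeg two_add_two_eq_four,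
      wedge_self_castDeg_mem_closedSmoothForms hs⟩ ≠ 0 :=
    deRhamCohomology_mk_ne_zero_of_forall_ne_zero (wedge_self_castDeg_mem_closedSmoothForms hs)
      (wedge_self_castDeg_apply_ne_zero s hnd)
  have he0 : e N 4 (deRhamCohomology.mk ⟨(s.wedge s).castDeg two_add_two_eq_four,
      wedge_self_castDeg_mem_closedSmoothForms hs⟩) ≠ 0 :=
    fun h0 ↦ hmk ((LinearEquiv.map_eq_zero_iff _).1 h0)
  exact fun h0 ↦ he0 (eq_zero_of_kroneckerPairing_coeffChange_fundamentalClass_eq_zero ℝ μ h0)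

/-- **For one of the two orientations `±μ` the real cup square of `e [s]` is positive**
(`[N]_{-μ} = -[N]_μ`, Hatcher (2002), p. 236, and the pairing is non-zero for both).
[cite: McDuffSalamon2017, proof of Thm. 13.3.11] -/
theorem exists_orientation_kroneckerPairing_cupProduct_pos (e : DeRhamIsoFamily (𝓡 4))
    (he : e.IsMultiplicative) (μ₀ : HomologicalOrientation ℤ N 4) {s : MForm (𝓡 4) N ℝ 2}
    (hs : s ∈ closedSmoothForms (𝓡 4) N ℝ 2)
    (hnd : ∀ x (v : TangentSpace (𝓡 4) x), v ≠ 0 → ∃ w : TangentSpace (𝓡 4) x, s x ![v, w] ≠ 0) :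
    ∃ μ : HomologicalOrientation ℤ N 4, 0 < kroneckerPairing ℝ ℝ N 4
        (cupProduct two_add_two_eq_four (e N 2 (deRhamCohomology.mk ⟨s, hs⟩))
          (e N 2 (deRhamCohomology.mk ⟨s, hs⟩)))
        (singularHomology.coeffChange N (algebraMap ℤ ℝ : ℤ →+* ℝ).toAddMonoidHom 4
          μ.fundamentalClass) := by
  have h0 := kroneckerPairing_cupProduct_deRhamIso_ne_zero e he μ₀ hs hnd
  rcases lt_or_gt_of_ne h0 with hneg | hpos
  · refine ⟨-μ₀, ?_⟩
    rw [HomologicalOrientation.fundamentalClass_neg_holds (R := ℤ) (X := N) 4 μ₀, map_neg, map_neg]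
    exact neg_pos.2 hneg
  · exact ⟨μ₀, hpos⟩

/-- **`b⁺ ≥ 1` for closed symplectic `4`-manifolds, from a multiplicative de Rham isomorphism
family.** For a closed connected smooth `4`-manifold `N` and a smooth closed pointwise
non-degenerate `2`-form `s`, granted a de Rham isomorphism family `e` on `ℝ⁴`-manifolds that is
multiplicative, there is a homological `ℤ`-orientation `μ` of `N` (the symplectic one) with
`1 ≤ sigPos Q_{N, μ}` = `b⁺(N, μ) ≥ 1` (McDuff–Salamon (2017), §4.4 after Ex. 4.4.1 and proof of
Thm. 13.3.11: `[ω] ∪ [ω] > 0`; then `one_le_sigPos_intersectionForm_of_real`).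
[cite: McDuffSalamon2017, §4.4 after Ex. 4.4.1; proof of Thm. 13.3.11] -/
theorem exists_orientation_one_le_sigPos_of_deRhamIsoFamily (e : DeRhamIsoFamily (𝓡 4))
    (he : e.IsMultiplicative) (s : MForm (𝓡 4) N ℝ 2) (hs : IsSmoothForm s) (hcl : IsClosedForm s)
    (hnd : ∀ x (v : TangentSpace (𝓡 4) x), v ≠ 0 → ∃ w : TangentSpace (𝓡 4) x, s x ![v, w] ≠ 0) :
    ∃ μ : HomologicalOrientation ℤ N 4, 1 ≤ sigPos (intersectionForm two_add_two_eq_four μ).toQuadraticMap := by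
  obtain ⟨μ, hμ⟩ := exists_orientation_kroneckerPairing_cupProduct_pos e he
    (symplecticOrientation s hs hnd) (s := s) ⟨hs, hcl⟩ hnd
  exact ⟨μ, one_le_sigPos_intersectionForm_of_real μ two_add_two_eq_four hμ⟩

/-- **Conjunct (i) of `canonicalClass_sq_and_adjunction_of_symplectic_four`, modulo de Rham's
theorem.** For a closed connected smooth `4`-manifold `N` carrying a smooth closed pointwise
non-degenerate `2`-form `s` (a symplectic form), GRANTED the named fact
`exists_deRhamIsoFamily (𝓡 4)` of `Literature/NumberTheory/Transcendental/DeRhamTheorem.lean`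
(de Rham's theorem, natural + multiplicative + normalised; Warner (1983), Thm. 5.36 / 5.45 — an
existing named fact of the tree, here an explicit hypothesis), there is a homological
`ℤ`-orientation `μ` of `N` with `b⁺ ≥ 1`, i.e. `1 ≤ sigPos Q_{N, μ}` (McDuff–Salamon (2017), proof
of Thm. 13.3.11). [cite: McDuffSalamon2017, proof of Thm. 13.3.11] [cite: WarnerGTM94, Thm. 5.36 and Thm. 5.45] -/
theorem exists_orientation_one_le_sigPos_of_exists_deRhamIsoFamily
    (hdR : exists_deRhamIsoFamily (𝓡 4)) (s : MForm (𝓡 4) N ℝ 2) (hs : IsSmoothForm s)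
    (hcl : IsClosedForm s)
    (hnd : ∀ x (v : TangentSpace (𝓡 4) x), v ≠ 0 → ∃ w : TangentSpace (𝓡 4) x, s x ![v, w] ≠ 0) :
    ∃ μ : HomologicalOrientation ℤ N 4, 1 ≤ sigPos (intersectionForm two_add_two_eq_four μ).toQuadraticMap := by
  obtain ⟨e, -, he, -⟩ := hdR
  exact exists_orientation_one_le_sigPos_of_deRhamIsoFamily e he s hs hcl hnd

/-! ### Conjunct (i) unconditionally -/

/-- **The class of a symplectic form on a closed `4`-manifold is non-zero in `H²_dR(N)`**: if
`s = dθ` then `s ∧ s = dθ ∧ s = d(θ ∧ s)` would be exact (`wedge_mem_exactSmoothForms_of_left`),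
but the volume form `s ∧ s` is not (`MForm.not_mem_exactSmoothForms_of_forall_ne_zero`, Stokes).
McDuff–Salamon (2017), §4.4 after Ex. 4.4.1 (`[ω] ≠ 0`). [cite: McDuffSalamon2017, §4.4 after Ex. 4.4.1] -/
theorem deRhamCohomology_mk_ne_zero_of_nondegenerate {s : MForm (𝓡 4) N ℝ 2}
    (hs : s ∈ closedSmoothForms (𝓡 4) N ℝ 2)
    (hnd : ∀ x (v : TangentSpace (𝓡 4) x), v ≠ 0 → ∃ w : TangentSpace (𝓡 4) x, s x ![v, w] ≠ 0) :
    deRhamCohomology.mk ⟨s, hs⟩ ≠ 0 := by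
  haveI := wedgeFacts_four (N := N)
  intro h0
  have hex : s ∈ exactSmoothForms (𝓡 4) N ℝ 2 := mem_exactSmoothForms_of_mk_eq_zero _ h0
  have hex4 : (s.wedge s).castDeg two_add_two_eq_four ∈ exactSmoothForms (𝓡 4) N ℝ 4 :=
    castDeg_mem_exactSmoothForms two_add_two_eq_four (wedge_mem_exactSmoothForms_of_left hex hs)
  exact MForm.not_mem_exactSmoothForms_of_forall_ne_zero (wedge_self_castDeg_mem_closedSmoothForms hs).1
    (wedge_self_castDeg_apply_ne_zero s hnd) hex4

/-- **Conjunct (i) of `canonicalClass_sq_and_adjunction_of_symplectic_four`, unconditionally.**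
For a closed connected smooth `4`-manifold `N` with a smooth closed pointwise non-degenerate
`2`-form `s`, there is a homological `ℤ`-orientation `μ` of `N` with `b⁺ ≥ 1`, i.e.
`1 ≤ sigPos Q_{N, μ}`: `[s] ≠ 0` (`deRhamCohomology_mk_ne_zero_of_nondegenerate`), so
`H²(N; ℝ) ≠ 0` by de Rham's (additive) isomorphism `integrationDeRhamIsoFamily`, and a non-zero
real middle class forces `b⁺ ≥ 1` for one of the two orientations
(`exists_orientation_one_le_sigPos_of_ne_zero`: the real cup pairing is symmetric and perfect).
(For the SYMPLECTIC orientation specifically — as needed together with conjunct (ii) — see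
`exists_orientation_one_le_sigPos_of_exists_deRhamIsoFamily`.) McDuff–Salamon (2017), §4.4 after
Ex. 4.4.1; proof of Thm. 13.3.11. [cite: McDuffSalamon2017, §4.4 after Ex. 4.4.1; proof of Thm. 13.3.11] -/
theorem exists_orientation_one_le_sigPos (s : MForm (𝓡 4) N ℝ 2) (hs : IsSmoothForm s)
    (hcl : IsClosedForm s)
    (hnd : ∀ x (v : TangentSpace (𝓡 4) x), v ≠ 0 → ∃ w : TangentSpace (𝓡 4) x, s x ![v, w] ≠ 0) :
    ∃ μ : HomologicalOrientation ℤ N 4, 1 ≤ sigPos (intersectionForm two_add_two_eq_four μ).toQuadraticMap := by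
  have hmk := deRhamCohomology_mk_ne_zero_of_nondegenerate (s := s) ⟨hs, hcl⟩ hnd
  have hy : integrationDeRhamIsoFamily (EuclideanSpace ℝ (Fin 4)) N 2 (deRhamCohomology.mk ⟨s, ⟨hs, hcl⟩⟩) ≠ 0 :=
    fun h0 ↦ hmk ((LinearEquiv.map_eq_zero_iff _).1 h0)
  exact exists_orientation_one_le_sigPos_of_ne_zero even_two (symplecticOrientation s hs hnd)
    two_add_two_eq_four hy

/-- **Conjuncts (i) and (iii)(a) of `canonicalClass_sq_and_adjunction_of_symplectic_four`,
proved, in its exact binders**: for a closed connected smooth `4`-manifold `N` with a smooth closed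
pointwise non-degenerate `2`-form `s`, (i) some homological `ℤ`-orientation `μ` of `N` has
`b⁺ ≥ 1`, `1 ≤ sigPos Q_{N, μ}` (McDuff–Salamon (2017), §4.4 / proof of Thm. 13.3.11: `[ω] ≠ 0`
since `ω ∧ ω` is a volume form — `exists_orientation_one_le_sigPos`), and (iii)(a) for every compact
connected surface `S` smoothly embedded by `b` with `s` non-degenerate on it and EVERY orientation
`μS` of `S`, the class `b_*[S]_{μS} ∈ H₂(N; ℤ)` is not torsion (Ex. 4.4.5 / proof of
Thm. 13.3.11: `∫_S ω > 0` — `map_fundamentalClass_not_mem_torsion_of_isSmoothEmbedding`).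
[cite: McDuffSalamon2017, §4.4 after Ex. 4.4.1; Ex. 4.4.5; proof of Thm. 13.3.11] -/
theorem canonicalClass_sq_and_adjunction_of_symplectic_four_parts_i_iiia :
    ∀ (N : Type) [TopologicalSpace N] [T2Space N] [SecondCountableTopology N] [CompactSpace N]
      [ConnectedSpace N] [ChartedSpace (EuclideanSpace ℝ (Fin 4)) N] [IsManifold (𝓡 4) ∞ N]
      (s : MForm (𝓡 4) N ℝ 2), IsSmoothForm s → IsClosedForm s →
      (∀ x (v : TangentSpace (𝓡 4) x), v ≠ 0 → ∃ w : TangentSpace (𝓡 4) x, s x ![v, w] ≠ 0) →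
      (∃ μ : HomologicalOrientation ℤ N 4,
        1 ≤ sigPos (intersectionForm two_add_two_eq_four μ).toQuadraticMap) ∧
      ∀ (S : Type) [TopologicalSpace S] [CompactSpace S] [ConnectedSpace S]
        [ChartedSpace (EuclideanSpace ℝ (Fin 2)) S] [IsManifold (𝓡 2) ∞ S] (b : S → N)
        (hb : Manifold.IsSmoothEmbedding (𝓡 2) (𝓡 4) ∞ b),
        (∀ y (v : TangentSpace (𝓡 2) y), v ≠ 0 → ∃ w : TangentSpace (𝓡 2) y,
          s (b y) ![mfderiv (𝓡 2) (𝓡 4) b y v, mfderiv (𝓡 2) (𝓡 4) b y w] ≠ 0) →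
        ∀ μS : HomologicalOrientation ℤ S 2,
          singularHomology.map ℤ ℤ ⟨b, hb.isEmbedding.continuous⟩ 2 μS.fundamentalClass ∉
            Submodule.torsion ℤ ↥(singularHomology ℤ ℤ N 2) :=
  fun _N _ _ _ _ _ _ _ s hs hcl hnd ↦
    ⟨exists_orientation_one_le_sigPos s hs hcl hnd, fun _S _ _ _ _ _ b hb hbnd μS ↦
      map_fundamentalClass_not_mem_torsion_of_isSmoothEmbedding s hs hcl b hb hbnd μS⟩

end Literature.Geometry.Symplectic
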